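import Summits.CriticalPhenomena.PercolationContinuityZ3.Theorems.PercNearOneGluingNoHeavyLowerTailQ44ComplementaryPacking
import Mathlib.Combinatorics.SetFamily.FourFunctions
import HarnessLib

/-!
# Conjecture W (row `Q44`): the terminal-pair HALVES are theorems — two Marica–Schönheim packings sharing capacity-2 goods

Support file for crux `stmt-CriticalPhenomena-4575` (master-family programme; Conjecture W = `TwoCopyMono.kerQ44` / `ConjW.law`, open for
all `n`), seat `prim-l12-p6` gen 30; memo `run/shared/lean/prim/prim-l12/FROM-prim-l12-p6-g30-MONOTONE-HALL.md` §1b.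

CONTEXT.  With the ORDERED kernel of W (`ConjW.bil`: goods `2·[i ∈ AC][j = ⊥]`, the ten `B1` pairs in both orientations, the eight darts
`(pair ; block)`), the fibre count of W splits along every edge `e` into the half over the subsets containing `e` and the half over
those avoiding `e`.  The memo's census (all 2 032 600 simple graphs on ≤ 7 vertices) finds the `e`-containing half nonnegative for EVERY
edge ("H10"), although the other half is often negative.  When `e = st` joins two TERMINALS, contracting `e` is the join `ι S ∨ st` in the
partition lattice, so H10 at `st` is a statement about ONE monotone cell map `ι`:
`2·#{S : ι S ∨ st ∈ AC, ι Sᶜ = ⊥} ≥ #{S : (ι S ∨ st, ι Sᶜ) ∈ B1sym ∪ Darts}`.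
Writing `U_st = {i : i ∨ st ∈ AC}` (an up-set) and `P_st` for the finite set of bad types `(i, j)` with `(i ∨ st, j)` bad, this file PROVES
it for every monotone `ι` (hence on every graph fibre, hence at law level for every finite weighted graph), for all six terminal pairs:

* `ConjWHalves.card_types_le_card_goods` — the abstract count: if a type set `Q` passes the MARICA–SCHÖNHEIM TABLE CHECK against the
  up-set `U` (for all `(h₁,l₁), (h₂,l₂) ∈ Q`: every cell above `h₁` and `l₂` lies in `U`, every cell below `l₁` and `h₂` is `⊥`), then
  `#{S : (ι S, ι Sᶜ) ∈ Q} ≤ #{S : ι S ∈ U, ι Sᶜ = ⊥}` — every difference `S ∖ S'` of two `Q`-points has a GOOD complement, and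
  `|𝓕 ∖∖ 𝓕| ≥ |𝓕|` (`Finset.card_le_card_diffs`);
* `ConjWHalves.goodKernel_two_packings` — for two such type sets `Q₁, Q₂` the kernel `2·[i ∈ U][j = ⊥] − [Q₁] − [Q₂]` is a
  `TwoCopyMono.GoodKernel`, and `ConjWHalves.sum_cells_le_of_two_packings` is the law-level form
  `Σ_{Q₁} cᵢcⱼ + Σ_{Q₂} cᵢcⱼ ≤ 2·(Σ_{u ∈ U} c_u)·c_⊥` on every finite weighted graph;
* the six terminal-pair halves of W (`half_ab`, `half_cy`, `half_ac`, `half_by`, `half_ay`, `half_bc`; written-out forms `half_ab_expanded`,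
  `half_ay_expanded`), each by a 2-split of `P_st` into
  MS-valid type sets found by exhaustive search (table checks by `decide`), e.g.
  `(ab)`: `2c₀(c₁+c₇+c₈+c₉+c₁₀+c₁₁+c₁₄) ≥ (c₀+c₆)(c₁+c₇+c₈+c₁₀) + (c₁+c₁₁)(c₈+c₉)`,
  `(ay)`: `2c₀(c₇+c₉+c₁₁+c₁₃+c₁₄) ≥ (c₃+c₈)(c₁+c₆+c₁₁)` (cells of `FourPointAtoms.pat4`).
These are the nonnegative halves `B(w[st ↦ 1], w[st ↦ 0])` of the terminal–terminal pencils `X_st` of W (p6 gen 25; `X_st ≥ 0` is necessary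
for W and stays open).  For W's own 18 bad types no split into two MS-valid sets exists (memo §1b), in line with "W is not a sum of two
packings".  Pure finite combinatorics on top of the tree's two-copy bridge; no definitions, no named facts, no sorries, standard axioms.
-/

namespace Summit.CriticalPhenomena.PercolationContinuityZ3.Theorems

namespace ConjWHalves

open Finset TwoCopyMono FourPointAtoms
open scoped FinsetFamily

/-! ## The abstract count: one Marica–Schönheim packing against up-set goods -/

/-- **Marica–Schönheim packing with up-set goods.**  Let `ι` be a monotone cell map on the subsets of a finite type, `U` a set of cells and
`Q` a set of (first, second) cell types such that for all `(h₁,l₁), (h₂,l₂) ∈ Q` every cell above both `h₁` and `l₂` lies in `U` and every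
cell below both `l₁` and `h₂` is `⊥`.  Then `#{S : (ι S, ι Sᶜ) ∈ Q} ≤ #{S : ι S ∈ U ∧ ι Sᶜ = ⊥}`: the complement of every difference
`S ∖ S'` of two `Q`-points is such a good point, and there are at least `#Q-points` differences (Marica–Schönheim). [this work] -/
theorem card_types_le_card_goods {γ : Type*} [Fintype γ] [DecidableEq γ] (ι : Finset γ → Fin 15)
    (hmono : ∀ X Y : Finset γ, X ⊆ Y → ple (ι X) (ι Y) = true) {U : Finset (Fin 15)} {Q : Finset (Fin 15 × Fin 15)}
    (hQ : ∀ p ∈ Q, ∀ q ∈ Q, (∀ x : Fin 15, ple p.1 x = true → ple q.2 x = true → x ∈ U) ∧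
      (∀ z : Fin 15, ple z p.2 = true → ple z q.1 = true → z = 0)) :
    #(Finset.univ.filter fun S : Finset γ => (ι S, ι Sᶜ) ∈ Q) ≤
      #(Finset.univ.filter fun S : Finset γ => ι S ∈ U ∧ ι Sᶜ = 0) := by
  classical
  set 𝒮 : Finset (Finset γ) := Finset.univ.filter fun S : Finset γ => (ι S, ι Sᶜ) ∈ Q with h𝒮
  have hgood : ∀ Z ∈ 𝒮 \\ 𝒮, ι Zᶜ ∈ U ∧ ι Zᶜᶜ = 0 := by
    intro Z hZ
    rw [mem_diffs] at hZ
    obtain ⟨S, hS, S', hS', rfl⟩ := hZ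
    rw [h𝒮, mem_filter] at hS hS'
    have hp := hQ _ hS'.2 _ hS.2
    have hsup1 : S' ⊆ (S \ S')ᶜ := by
      intro x hx
      rw [mem_compl, mem_sdiff, not_and, not_not]
      exact fun _ => hx
    have hsup2 : Sᶜ ⊆ (S \ S')ᶜ := by
      intro x hx
      rw [mem_compl] at hx
      rw [mem_compl, mem_sdiff, not_and]
      exact fun h => (hx h).elim
    have hsub1 : S \ S' ⊆ S'ᶜ := by
      intro x hx
      rw [mem_compl]
      exact (mem_sdiff.1 hx).2
    refine ⟨hp.1 _ (hmono _ _ hsup1) (hmono _ _ hsup2), ?_⟩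
    rw [compl_compl]
    exact hp.2 _ (hmono _ _ hsub1) (hmono _ _ sdiff_subset)
  calc #𝒮 ≤ #(𝒮 \\ 𝒮) := 𝒮.card_le_card_diffs
    _ ≤ #(Finset.univ.filter fun S : Finset γ => ι S ∈ U ∧ ι Sᶜ = 0) := by
        refine Finset.card_le_card_of_injOn (fun Z : Finset γ => Zᶜ) (fun Z hZ => ?_) (fun Z₁ _ Z₂ _ h => compl_injective h)
        rw [mem_coe] at hZ
        rw [mem_coe, mem_filter]
        exact ⟨mem_univ _, hgood Z hZ⟩

/-! ## Two packings sharing the goods: the kernel `2·[i ∈ U][j = ⊥] − [Q₁] − [Q₂]` -/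

/-- Points of type `U ×ˢ {⊥}` are the goods `ι S ∈ U ∧ ι Sᶜ = ⊥`. [this work] -/
theorem card_filter_goods {γ : Type*} [Fintype γ] [DecidableEq γ] (ι : Finset γ → Fin 15) (U : Finset (Fin 15)) :
    #(Finset.univ.filter fun T : Finset γ => (ι T, ι Tᶜ) ∈ U ×ˢ ({0} : Finset (Fin 15))) =
      #(Finset.univ.filter fun S : Finset γ => ι S ∈ U ∧ ι Sᶜ = 0) := by
  congr 1; ext S; simp only [mem_filter, mem_univ, true_and, mem_product, mem_singleton]

/-- **Two Marica–Schönheim packings against capacity-2 goods**: if both `Q₁` and `Q₂` pass the table check against `U`, the kernel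
`[i ∈ U][j = ⊥] + [i ∈ U][j = ⊥] − [(i,j) ∈ Q₁] − [(i,j) ∈ Q₂]` is a `GoodKernel`. [this work] -/
theorem goodKernel_two_packings {U : Finset (Fin 15)} {Q₁ Q₂ : Finset (Fin 15 × Fin 15)}
    (hQ₁ : ∀ p ∈ Q₁, ∀ q ∈ Q₁, (∀ x : Fin 15, ple p.1 x = true → ple q.2 x = true → x ∈ U) ∧
      (∀ z : Fin 15, ple z p.2 = true → ple z q.1 = true → z = 0))
    (hQ₂ : ∀ p ∈ Q₂, ∀ q ∈ Q₂, (∀ x : Fin 15, ple p.1 x = true → ple q.2 x = true → x ∈ U) ∧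
      (∀ z : Fin 15, ple z p.2 = true → ple z q.1 = true → z = 0)) :
    GoodKernel (fun i j => indK (U ×ˢ ({0} : Finset (Fin 15))) i j + indK (U ×ˢ ({0} : Finset (Fin 15))) i j -
      indK Q₁ i j - indK Q₂ i j) := by
  classical
  refine ⟨fun γ _ _ P hmono heqv => ?_⟩
  have hex : ∀ T : Finset γ, ∃ i : Fin 15, P T = pp i := fun T => exists_pat_of_isEqv (heqv T)
  choose ι hι using hex
  have hle : ∀ X Y : Finset γ, X ⊆ Y → ple (ι X) (ι Y) = true := by
    intro X Y hXY
    apply ple_of_profLE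
    rw [← hι X, ← hι Y]
    exact hmono X Y hXY
  have h1 := card_types_le_card_goods ι hle hQ₁
  have h2 := card_types_le_card_goods ι hle hQ₂
  rw [← card_filter_goods ι U] at h1 h2
  have hP : (∑ T : Finset γ, liftK (fun i j => indK (U ×ˢ ({0} : Finset (Fin 15))) i j +
      indK (U ×ˢ ({0} : Finset (Fin 15))) i j - indK Q₁ i j - indK Q₂ i j) (P T) (P Tᶜ)) =
      ∑ T : Finset γ, (indK (U ×ˢ ({0} : Finset (Fin 15))) (ι T) (ι Tᶜ) + indK (U ×ˢ ({0} : Finset (Fin 15))) (ι T) (ι Tᶜ) -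
        indK Q₁ (ι T) (ι Tᶜ) - indK Q₂ (ι T) (ι Tᶜ)) := by
    refine Finset.sum_congr rfl fun T _ => ?_
    rw [hι T, hι Tᶜ, liftK_pp]
  rw [hP, Finset.sum_sub_distrib, Finset.sum_sub_distrib, Finset.sum_add_distrib, sum_indK_map, sum_indK_map, sum_indK_map]
  have e1 : (#(Finset.univ.filter fun T : Finset γ => (ι T, ι Tᶜ) ∈ Q₁) : ℤ) ≤
      #(Finset.univ.filter fun T : Finset γ => (ι T, ι Tᶜ) ∈ U ×ˢ ({0} : Finset (Fin 15))) := by exact_mod_cast h1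
  have e2 : (#(Finset.univ.filter fun T : Finset γ => (ι T, ι Tᶜ) ∈ Q₂) : ℤ) ≤
      #(Finset.univ.filter fun T : Finset γ => (ι T, ι Tᶜ) ∈ U ×ˢ ({0} : Finset (Fin 15))) := by exact_mod_cast h2
  linarith

/-! ## Law level -/

variable {n : ℕ}

/-- **Law-level form**: if `Q₁, Q₂` pass the table check against `U`, then on every finite weighted graph and for all marked points
`Σ_{(i,j) ∈ Q₁} cᵢcⱼ + Σ_{(i,j) ∈ Q₂} cᵢcⱼ ≤ 2·Σ_{(u,⊥) ∈ U × {⊥}} c_u c_⊥`. [this work] -/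
theorem sum_cells_le_of_two_packings {U : Finset (Fin 15)} {Q₁ Q₂ : Finset (Fin 15 × Fin 15)}
    (hQ₁ : ∀ p ∈ Q₁, ∀ q ∈ Q₁, (∀ x : Fin 15, ple p.1 x = true → ple q.2 x = true → x ∈ U) ∧
      (∀ z : Fin 15, ple z p.2 = true → ple z q.1 = true → z = 0))
    (hQ₂ : ∀ p ∈ Q₂, ∀ q ∈ Q₂, (∀ x : Fin 15, ple p.1 x = true → ple q.2 x = true → x ∈ U) ∧
      (∀ z : Fin 15, ple z p.2 = true → ple z q.1 = true → z = 0))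
    (w : Sym2 (Fin n) → unitInterval) (a b c y : Fin n) :
    (∑ p ∈ Q₁, cell w a b c y p.1 * cell w a b c y p.2) + (∑ p ∈ Q₂, cell w a b c y p.1 * cell w a b c y p.2) ≤
      2 * ∑ p ∈ U ×ˢ ({0} : Finset (Fin 15)), cell w a b c y p.1 * cell w a b c y p.2 := by
  have h0 := sum_kernel_cell_nonneg (goodKernel_two_packings hQ₁ hQ₂) w a b c y
  have hsplit : ∀ i j : Fin 15,
      ((indK (U ×ˢ ({0} : Finset (Fin 15))) i j + indK (U ×ˢ ({0} : Finset (Fin 15))) i j - indK Q₁ i j - indK Q₂ i j : ℤ) : ℝ) *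
          cell w a b c y i * cell w a b c y j =
        ((indK (U ×ˢ ({0} : Finset (Fin 15))) i j : ℝ) * cell w a b c y i * cell w a b c y j +
          (indK (U ×ˢ ({0} : Finset (Fin 15))) i j : ℝ) * cell w a b c y i * cell w a b c y j) -
          (indK Q₁ i j : ℝ) * cell w a b c y i * cell w a b c y j - (indK Q₂ i j : ℝ) * cell w a b c y i * cell w a b c y j := by
    intro i j; push_cast; ring
  simp_rw [hsplit, Finset.sum_sub_distrib, Finset.sum_add_distrib] at h0
  rw [sum_indK_cell, sum_indK_cell, sum_indK_cell] at h0
  linarith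

/-! ## The six terminal-pair halves of W

For a terminal pair `st`, `U_st = {i : i ∨ st ∈ {ab|cy, abcy}}` and the bad types are `{(i, j) : (i ∨ st, j) ∈ B1sym ∪ Darts}`; the
2-splits below were found by exhaustive search (memo §1b) and are checked here by `decide`. -/

/-- **Half of W at the pair `ab`**: `(c₁+c₁₁)(c₈+c₉) + (c₀+c₆)(c₁+c₇+c₈+c₁₀) ≤ 2c₀(c₁+c₇+c₈+c₉+c₁₀+c₁₁+c₁₄)`, i.e. types
`{cy, ab|cy} × {ay|bc, ac|by}` and `{⊥, ab} × {cy, bcy, ay|bc, acy}` against the goods `U_ab × {⊥}`,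
`U_ab = {cy, bcy, ay|bc, ac|by, acy, ab|cy, abcy}`. [this work] -/
theorem half_ab (w : Sym2 (Fin n) → unitInterval) (a b c y : Fin n) :
    (∑ p ∈ ({1, 11} : Finset (Fin 15)) ×ˢ ({8, 9} : Finset (Fin 15)), cell w a b c y p.1 * cell w a b c y p.2) +
        (∑ p ∈ ({0, 6} : Finset (Fin 15)) ×ˢ ({1, 7, 8, 10} : Finset (Fin 15)), cell w a b c y p.1 * cell w a b c y p.2) ≤
      2 * ∑ p ∈ ({1, 7, 8, 9, 10, 11, 14} : Finset (Fin 15)) ×ˢ ({0} : Finset (Fin 15)), cell w a b c y p.1 * cell w a b c y p.2 :=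
  sum_cells_le_of_two_packings (by decide +kernel) (by decide +kernel) w a b c y

/-- **Half of W at the pair `cy`** (the `(ab)(cy)`-image of `half_ab`): types `{ab, ab|cy} × {ay|bc, ac|by}` and
`{⊥, cy} × {ab, ay|bc, aby, abc}` against `U_cy = {ab, ay|bc, ac|by, ab|cy, aby, abc, abcy}`. [this work] -/
theorem half_cy (w : Sym2 (Fin n) → unitInterval) (a b c y : Fin n) :
    (∑ p ∈ ({6, 11} : Finset (Fin 15)) ×ˢ ({8, 9} : Finset (Fin 15)), cell w a b c y p.1 * cell w a b c y p.2) +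
        (∑ p ∈ ({0, 1} : Finset (Fin 15)) ×ˢ ({6, 8, 12, 13} : Finset (Fin 15)), cell w a b c y p.1 * cell w a b c y p.2) ≤
      2 * ∑ p ∈ ({6, 8, 9, 11, 12, 13, 14} : Finset (Fin 15)) ×ˢ ({0} : Finset (Fin 15)), cell w a b c y p.1 * cell w a b c y p.2 :=
  sum_cells_le_of_two_packings (by decide +kernel) (by decide +kernel) w a b c y

/-- **Half of W at the pair `ac`**: `(c₂+c₉)c₁₁ + (c₀+c₅)(c₇+c₁₂) ≤ 2c₀(c₇+c₈+c₁₁+c₁₂+c₁₄)`; types `{by, ac|by} × {ab|cy}` and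
`{⊥, ac} × {bcy, aby}` against `U_ac = {bcy, ay|bc, ab|cy, aby, abcy}` (the only valid 2-split). [this work] -/
theorem half_ac (w : Sym2 (Fin n) → unitInterval) (a b c y : Fin n) :
    (∑ p ∈ ({2, 9} : Finset (Fin 15)) ×ˢ ({11} : Finset (Fin 15)), cell w a b c y p.1 * cell w a b c y p.2) +
        (∑ p ∈ ({0, 5} : Finset (Fin 15)) ×ˢ ({7, 12} : Finset (Fin 15)), cell w a b c y p.1 * cell w a b c y p.2) ≤
      2 * ∑ p ∈ ({7, 8, 11, 12, 14} : Finset (Fin 15)) ×ˢ ({0} : Finset (Fin 15)), cell w a b c y p.1 * cell w a b c y p.2 :=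
  sum_cells_le_of_two_packings (by decide +kernel) (by decide +kernel) w a b c y

/-- **Half of W at the pair `by`** (image of `half_ac`): types `{ac, ac|by} × {ab|cy}` and `{⊥, by} × {acy, abc}` against
`U_by = {ay|bc, acy, ab|cy, abc, abcy}`. [this work] -/
theorem half_by (w : Sym2 (Fin n) → unitInterval) (a b c y : Fin n) :
    (∑ p ∈ ({5, 9} : Finset (Fin 15)) ×ˢ ({11} : Finset (Fin 15)), cell w a b c y p.1 * cell w a b c y p.2) +
        (∑ p ∈ ({0, 2} : Finset (Fin 15)) ×ˢ ({10, 13} : Finset (Fin 15)), cell w a b c y p.1 * cell w a b c y p.2) ≤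
      2 * ∑ p ∈ ({8, 10, 11, 13, 14} : Finset (Fin 15)) ×ˢ ({0} : Finset (Fin 15)), cell w a b c y p.1 * cell w a b c y p.2 :=
  sum_cells_le_of_two_packings (by decide +kernel) (by decide +kernel) w a b c y

/-- **Half of W at the pair `ay`**: `(c₃+c₈)(c₁+c₆+c₁₁) ≤ 2c₀(c₇+c₉+c₁₁+c₁₃+c₁₄)`; types `{ay|bc} × {ab|cy}` and
`{bc} × {cy, ab, ab|cy} ∪ {ay|bc} × {cy, ab}` against `U_ay = {bcy, ac|by, ab|cy, abc, abcy}`. [this work] -/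
theorem half_ay (w : Sym2 (Fin n) → unitInterval) (a b c y : Fin n) :
    (∑ p ∈ ({8} : Finset (Fin 15)) ×ˢ ({11} : Finset (Fin 15)), cell w a b c y p.1 * cell w a b c y p.2) +
        (∑ p ∈ ({(3, 1), (3, 6), (3, 11), (8, 1), (8, 6)} : Finset (Fin 15 × Fin 15)), cell w a b c y p.1 * cell w a b c y p.2) ≤
      2 * ∑ p ∈ ({7, 9, 11, 13, 14} : Finset (Fin 15)) ×ˢ ({0} : Finset (Fin 15)), cell w a b c y p.1 * cell w a b c y p.2 :=
  sum_cells_le_of_two_packings (by decide +kernel) (by decide +kernel) w a b c y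

/-- **Half of W at the pair `bc`** (image of `half_ay`): types `{ay|bc} × {ab|cy}` and `{ay} × {cy, ab, ab|cy} ∪ {ay|bc} × {cy, ab}`
against `U_bc = {ac|by, acy, ab|cy, aby, abcy}`. [this work] -/
theorem half_bc (w : Sym2 (Fin n) → unitInterval) (a b c y : Fin n) :
    (∑ p ∈ ({8} : Finset (Fin 15)) ×ˢ ({11} : Finset (Fin 15)), cell w a b c y p.1 * cell w a b c y p.2) +
        (∑ p ∈ ({(4, 1), (4, 6), (4, 11), (8, 1), (8, 6)} : Finset (Fin 15 × Fin 15)), cell w a b c y p.1 * cell w a b c y p.2) ≤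
      2 * ∑ p ∈ ({9, 10, 11, 12, 14} : Finset (Fin 15)) ×ˢ ({0} : Finset (Fin 15)), cell w a b c y p.1 * cell w a b c y p.2 :=
  sum_cells_le_of_two_packings (by decide +kernel) (by decide +kernel) w a b c y

/-- **Half of W at the pair `ay`, written out**: `(c₃+c₈)(c₁+c₆+c₁₁) ≤ 2c₀(c₇+c₉+c₁₁+c₁₃+c₁₄)` on every finite weighted graph, i.e.
`[μ(a|bc|y)+μ(ay|bc)]·[μ(a|b|cy)+μ(ab|c|y)+μ(ab|cy)] ≤ 2·μ(a|b|c|y)·[μ(a|bcy)+μ(ac|by)+μ(ab|cy)+μ(abc|y)+μ(abcy)]`. [this work] -/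
theorem half_ay_expanded (w : Sym2 (Fin n) → unitInterval) (a b c y : Fin n) :
    (cell w a b c y 3 + cell w a b c y 8) * (cell w a b c y 1 + cell w a b c y 6 + cell w a b c y 11) ≤
      2 * cell w a b c y 0 * (cell w a b c y 7 + cell w a b c y 9 + cell w a b c y 11 + cell w a b c y 13 + cell w a b c y 14) := by
  have h := half_ay w a b c y
  simp only [Finset.sum_product, Finset.sum_insert, Finset.mem_insert, Finset.mem_singleton, Finset.sum_singleton,
    Fin.reduceEq, Prod.mk.injEq, and_false, and_true, and_self, or_self, not_false_eq_true] at h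
  nlinarith [h]

/-- **Half of W at the pair `ab`, written out**: `(c₁+c₁₁)(c₈+c₉) + (c₀+c₆)(c₁+c₇+c₈+c₁₀) ≤ 2c₀(c₁+c₇+c₈+c₉+c₁₀+c₁₁+c₁₄)` on every finite
weighted graph and all marked points. [this work] -/
theorem half_ab_expanded (w : Sym2 (Fin n) → unitInterval) (a b c y : Fin n) :
    (cell w a b c y 1 + cell w a b c y 11) * (cell w a b c y 8 + cell w a b c y 9) +
        (cell w a b c y 0 + cell w a b c y 6) * (cell w a b c y 1 + cell w a b c y 7 + cell w a b c y 8 + cell w a b c y 10) ≤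
      2 * cell w a b c y 0 * (cell w a b c y 1 + cell w a b c y 7 + cell w a b c y 8 + cell w a b c y 9 + cell w a b c y 10 +
        cell w a b c y 11 + cell w a b c y 14) := by
  have h := half_ab w a b c y
  simp only [Finset.sum_product, Finset.sum_insert, Finset.mem_insert, Finset.mem_singleton, Finset.sum_singleton,
    Fin.reduceEq, or_self, not_false_eq_true] at h
  nlinarith [h]

end ConjWHalves

end Summit.CriticalPhenomena.PercolationContinuityZ3.Theorems
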